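import Mathlib
import HarnessLib
import Summits.ValiantsHypothesis.ValiantsHypothesis.Theorems.EquivariantDialLayersValiant

/-!
# Equivariant-dc dial, LAYERED notch (3/3): exact layerwise lifts become exact `GL × GL` lifts of
# Valiant's matrix — the bridge `PolyLayered ⟹ PolyEquivariant` and the kernels `S ⟹ W ⟹ A ⟹ A^lay`
# (decomp-valiant workshop, lens 1, generation 14) — support file; NOT a route

HONEST FRAMING.  `VP ≠ VNP` is NOT proved here; third of three sorry-free SUPPORT files of the census cell
`A = EquivariantDialNode.EqHardBiPerm` (item `stmt-ValiantsHypothesis-23702`, supported, not closed).  See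
`EquivariantDialLayers` (1/3) for the model, the cut lemma, the cell `A^lay = EqHardLayeredBiPerm` and its
census tags, and `EquivariantDialLayersValiant` (2/3) for Valiant's matrix `vmat`.

## What is proved

* The lifts are BLOCK-DIAGONAL in the levels: for an exact layerwise lift `Λ : P.Lift γ`
  (`T t (γ·x) = R t · T t · (R (t+1))⁻¹`, source/sink eigenvalues `a`, `b`),
  `g = diag(a·1, R 0, …, R L, diag(a, b, …, b))` (`gBlk`, `gGL`) and `h = diag(a·1, R 0, …, R L, b·1)`
  (`hBlk`, `hGL`) satisfy `g · V = V(γ·x) · h` for Valiant's matrix `V` — block by block: `blk_lift` (the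
  program's three identities `Lift.src` / `Lift.layer` / `Lift.snk`, inverse-free), `vblk_lift`, `vmat_lift`.
* **Bridge theorem** `LayeredABP.hasEquivariantDetRepr_of_isEquivariant`: a `Γ`-equivariant layered program
  of length `L` and width `w ≥ 1` yields an EXACTLY `Γ`-equivariant affine determinantal representation
  (`HasEquivariantDetRepr`, Landsberg–Ressayre [LandsbergRessayre2017, Def 1.3]) of size `w (L + 3)`;
  existential form `HasLayeredWidthLE.exists_hasEquivariantDetRepr` (size `≤ w (L+3) + 1`, width `0` included).
* Kernels over `ℂ` at every notch `H`: `polyEquivariant_of_polyLayered`, `eqHardLayered_of_eqHard`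
  (`A ⟹ A^lay`), and at the bi-permutation window `eqHardLayeredBiPerm_of_eqHardBiPerm`,
  `eqHardLayeredBiPerm_of_dcPerSuperpolynomial` (`W ⟹ A^lay`), `eqHardLayeredBiPerm_of_summit` (`S ⟹ A^lay`).
  So `A^lay` is a NECESSARY piece (WEAKER · NEC); no converse is claimed.
-/

set_option linter.dupNamespace false

namespace Summit.ValiantsHypothesis.ValiantsHypothesis.Theorems.EquivariantDialLayers

open MvPolynomial Matrix Literature.Computability.AlgebraicComplexity
open Summit.ValiantsHypothesis.ValiantsHypothesis.Theorems.EquivariantDialNode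
open Summit.ValiantsHypothesis.ValiantsHypothesis.Theorems.EquivariantDialGrading

noncomputable section

section Lifts

variable {σ : Type*} {k : Type*} [CommRing k] {L w : ℕ}

namespace LayeredABP

variable {P : LayeredABP σ k L w} [NeZero w] [Fintype σ] [DecidableEq σ] {γ : GL σ k}

/-- Right lift `h`, by levels: `a · 1` on level `0`, `R 0, …, R L` on the program's layers, `b · 1` on the
sink level. -/
def hBlk (Λ : P.Lift γ) (c : Fin (L + 3)) : Matrix (Fin w) (Fin w) k :=
  if c.val = 0 then (Λ.a : k) • 1
  else if h : c.val - 1 < L + 1 then ((Λ.R ⟨c.val - 1, h⟩ : GL (Fin w) k) : Matrix (Fin w) (Fin w) k)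
  else (Λ.b : k) • 1

/-- Its inverse, by levels. -/
def hInvBlk (Λ : P.Lift γ) (c : Fin (L + 3)) : Matrix (Fin w) (Fin w) k :=
  if c.val = 0 then ((Λ.a⁻¹ : kˣ) : k) • 1
  else if h : c.val - 1 < L + 1 then (((Λ.R ⟨c.val - 1, h⟩)⁻¹ : GL (Fin w) k) : Matrix (Fin w) (Fin w) k)
  else ((Λ.b⁻¹ : kˣ) : k) • 1

/-- Left lift `g`: equal to `h` except on the sink level, where the sink slot carries `a` (the sink ROW of
Valiant's matrix is the source unit vector) and the isolated slots carry `b`. -/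
def gBlk (Λ : P.Lift γ) (c : Fin (L + 3)) : Matrix (Fin w) (Fin w) k :=
  if c.val = L + 2 then Matrix.diagonal fun i => if i = 0 then (Λ.a : k) else (Λ.b : k) else hBlk Λ c

/-- Its inverse, by levels. -/
def gInvBlk (Λ : P.Lift γ) (c : Fin (L + 3)) : Matrix (Fin w) (Fin w) k :=
  if c.val = L + 2 then Matrix.diagonal fun i => if i = 0 then ((Λ.a⁻¹ : kˣ) : k) else ((Λ.b⁻¹ : kˣ) : k)
  else hInvBlk Λ c

omit [NeZero w] in
/-- `(c · 1) (c⁻¹ · 1) = 1`. -/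
theorem units_smul_one_mul_inv_smul_one (c : kˣ) :
    ((c : k) • (1 : Matrix (Fin w) (Fin w) k)) * (((c⁻¹ : kˣ) : k) • (1 : Matrix (Fin w) (Fin w) k)) = 1 := by
  rw [Matrix.smul_mul, Matrix.one_mul, smul_smul, Units.mul_inv, one_smul]

omit [NeZero w] in
/-- The right lift blocks are invertible. -/
theorem hBlk_mul_hInvBlk (Λ : P.Lift γ) (c : Fin (L + 3)) : hBlk Λ c * hInvBlk Λ c = 1 := by
  unfold hBlk hInvBlk
  split_ifs
  · exact units_smul_one_mul_inv_smul_one _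
  · rw [← Units.val_mul, mul_inv_cancel, Units.val_one]
  · exact units_smul_one_mul_inv_smul_one _

/-- The left lift blocks are invertible. -/
theorem gBlk_mul_gInvBlk (Λ : P.Lift γ) (c : Fin (L + 3)) : gBlk Λ c * gInvBlk Λ c = 1 := by
  unfold gBlk gInvBlk
  split_ifs
  · rw [Matrix.diagonal_mul_diagonal, ← Matrix.diagonal_one]
    congr 1
    funext i
    split_ifs <;> simp
  · exact hBlk_mul_hInvBlk Λ c

/-- The right lift as an element of `GL(V)`. -/
def hGL (Λ : P.Lift γ) : GL (Vtx L w) k :=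
  ⟨Matrix.blockDiagonal (hBlk Λ), Matrix.blockDiagonal (hInvBlk Λ),
    by rw [← Matrix.blockDiagonal_mul, show (fun c => hBlk Λ c * hInvBlk Λ c) = 1 from
      funext (hBlk_mul_hInvBlk Λ), Matrix.blockDiagonal_one],
    by rw [mul_eq_one_comm, ← Matrix.blockDiagonal_mul, show (fun c => hBlk Λ c * hInvBlk Λ c) = 1 from
      funext (hBlk_mul_hInvBlk Λ), Matrix.blockDiagonal_one]⟩

/-- The left lift as an element of `GL(V)`. -/
def gGL (Λ : P.Lift γ) : GL (Vtx L w) k :=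
  ⟨Matrix.blockDiagonal (gBlk Λ), Matrix.blockDiagonal (gInvBlk Λ),
    by rw [← Matrix.blockDiagonal_mul, show (fun c => gBlk Λ c * gInvBlk Λ c) = 1 from
      funext (gBlk_mul_gInvBlk Λ), Matrix.blockDiagonal_one],
    by rw [mul_eq_one_comm, ← Matrix.blockDiagonal_mul, show (fun c => gBlk Λ c * gInvBlk Λ c) = 1 from
      funext (gBlk_mul_gInvBlk Λ), Matrix.blockDiagonal_one]⟩

/-- The three lift identities of the program, in the form `h_a · B_a = B_a(γ·x) · h_{a+1}` (no inverses):
source block (`Lift.src`), layer blocks (`Lift.layer`), sink block (`Lift.snk`). -/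
theorem blk_lift (Λ : P.Lift γ) (a b : Fin (L + 3)) (hab : a.val + 1 = b.val) :
    (hBlk Λ a).map C * P.blk a.val = Matrix.linSubstEntries γ (P.blk a.val) * (hBlk Λ b).map C := by
  obtain ⟨a, ha⟩ := a
  obtain ⟨b, hb⟩ := b
  simp only at hab
  subst hab
  rcases Nat.eq_zero_or_pos a with rfl | hpos
  · -- source block
    rw [blk_zero, Matrix.linSubstEntries_map_C]
    simp only [hBlk, if_true, zero_add, one_ne_zero, if_false, Nat.lt_succ_iff]
    rw [← Matrix.map_mul, ← Matrix.map_mul]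
    congr 1
    rw [Matrix.smul_mul, Matrix.one_mul]
    ext i j
    rw [Matrix.smul_apply, srcK, Matrix.mul_apply]
    by_cases hi : i = 0
    · subst hi
      have h := congrFun Λ.src j
      simp only [Matrix.vecMul, dotProduct, Pi.smul_apply, smul_eq_mul] at h
      simp only [Matrix.of_apply, if_true, smul_eq_mul]
      rw [← h]
      rfl
    · simp [hi]
  · obtain ⟨a, rfl⟩ := Nat.exists_eq_succ_of_ne_zero hpos.ne'
    by_cases haL : a < L
    · -- layer block
      rw [P.blk_succ ⟨a, haL⟩]
      have hl := Λ.layer ⟨a, haL⟩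
      simp only [hBlk, Nat.succ_ne_zero, if_false, Nat.succ_sub_one]
      rw [dif_pos (by omega), dif_pos (by omega), hl]
      rw [Matrix.mul_assoc, ← Matrix.map_mul, ← Units.val_mul]
      have h1 : (⟨a, haL⟩ : Fin L).succ = ⟨a + 1, by omega⟩ := rfl
      have h2 : (⟨a, haL⟩ : Fin L).castSucc = ⟨a, by omega⟩ := rfl
      rw [h1, h2, inv_mul_cancel, Units.val_one, Matrix.map_one C C_0 C_1, Matrix.mul_one]
    · -- sink block
      obtain rfl : a = L := by omega
      rw [blk_last, Matrix.linSubstEntries_map_C]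
      simp only [hBlk, Nat.succ_ne_zero, if_false, Nat.succ_sub_one, lt_add_one, dif_pos,
        lt_irrefl, dif_neg, not_false_eq_true]
      rw [← Matrix.map_mul, ← Matrix.map_mul]
      congr 1
      rw [Matrix.mul_smul, Matrix.mul_one]
      ext i j
      rw [Matrix.smul_apply, snkK, Matrix.mul_apply]
      by_cases hj : j = 0
      · subst hj
        have h := congrFun Λ.snk i
        simp only [Matrix.mulVec, dotProduct, Pi.smul_apply, smul_eq_mul] at h
        simp only [Matrix.of_apply, if_true, smul_eq_mul]
        rw [← h]
        rfl
      · simp [hj]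

/-- Blockwise lift identity for Valiant's matrix: `g_a · V_{ab} = V_{ab}(γ·x) · h_b`. -/
theorem vblk_lift (Λ : P.Lift γ) (a b : Fin (L + 3)) :
    (gBlk Λ a).map C * P.vblk a b = Matrix.linSubstEntries γ (P.vblk a b) * (hBlk Λ b).map C := by
  by_cases ha : a.val = L + 2
  · -- sink level: constant blocks
    have hg : gBlk Λ a = Matrix.diagonal fun i => if i = 0 then (Λ.a : k) else (Λ.b : k) := by
      simp [gBlk, ha]
    rw [hg]
    by_cases hb0 : b.val = 0
    · have hv : P.vblk a b = (e00 w : Matrix (Fin w) (Fin w) k).map C := by simp [vblk, ha, hb0]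
      have hh : hBlk Λ b = (Λ.a : k) • (1 : Matrix (Fin w) (Fin w) k) := by simp [hBlk, hb0]
      rw [hv, hh, Matrix.linSubstEntries_map_C, ← Matrix.map_mul, ← Matrix.map_mul]
      congr 1
      rw [Matrix.mul_smul, Matrix.mul_one]
      refine Matrix.ext fun i j => ?_
      simp only [e00, Matrix.diagonal_mul, Matrix.of_apply, Matrix.smul_apply, smul_eq_mul]
      by_cases hi : i = 0 <;> simp [hi]
    · by_cases hbL : b.val = L + 2
      · have hv : P.vblk a b = (isoK w : Matrix (Fin w) (Fin w) k).map C := by simp [vblk, ha, hbL]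
        have hh : hBlk Λ b = (Λ.b : k) • (1 : Matrix (Fin w) (Fin w) k) := by simp [hBlk, hbL]
        rw [hv, hh, Matrix.linSubstEntries_map_C, ← Matrix.map_mul, ← Matrix.map_mul]
        congr 1
        rw [Matrix.mul_smul, Matrix.mul_one]
        refine Matrix.ext fun i j => ?_
        simp only [isoK, Matrix.diagonal_mul_diagonal, Matrix.smul_apply, Matrix.diagonal_apply, smul_eq_mul]
        by_cases hij : i = j
        · subst hij
          by_cases hi : i = 0 <;> simp [hi]
        · simp [hij]
      · have hv : P.vblk a b = 0 := by simp [vblk, ha, hb0, hbL]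
        rw [hv, Matrix.mul_zero, linSubstEntries_zero_aux, Matrix.zero_mul]
  · -- the program's levels
    have hg : gBlk Λ a = hBlk Λ a := by simp [gBlk, ha]
    rw [hg]
    by_cases hab : a = b
    · subst hab
      have hv : P.vblk a a = 1 := by simp [vblk, ha]
      rw [hv, Matrix.mul_one, linSubstEntries_one_aux, Matrix.one_mul]
    · by_cases hab1 : a.val + 1 = b.val
      · have hv : P.vblk a b = -P.blk a.val := by simp [vblk, ha, hab, hab1]
        rw [hv, Matrix.mul_neg, linSubstEntries_neg_aux, Matrix.neg_mul, blk_lift Λ a b hab1]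
      · have hv : P.vblk a b = 0 := by simp [vblk, ha, hab, hab1]
        rw [hv, Matrix.mul_zero, linSubstEntries_zero_aux, Matrix.zero_mul]

/-- **The lift identity for Valiant's matrix**: `g · V = V(γ·x) · h`. -/
theorem vmat_lift (Λ : P.Lift γ) :
    (Matrix.blockDiagonal (gBlk Λ)).map (C : k →+* MvPolynomial σ k) * P.vmat =
      Matrix.linSubstEntries γ P.vmat * (Matrix.blockDiagonal (hBlk Λ)).map (C : k →+* MvPolynomial σ k) := by
  refine Matrix.ext fun ⟨i, a⟩ ⟨j, b⟩ => ?_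
  rw [Matrix.blockDiagonal_map _ _ (map_zero C), Matrix.blockDiagonal_map _ _ (map_zero C),
    blockDiagonal_mul_apply, mul_blockDiagonal_apply]
  have h := vblk_lift Λ a b
  rw [← vmat_submatrix_level] at h
  exact congrFun (congrFun h i) j

/-- **Bridge theorem.** An equivariant layered program of length `L` and width `w ≥ 1` yields an EXACTLY
equivariant affine determinantal representation of size `w · (L + 3)` (Valiant's construction with lifts). -/
theorem hasEquivariantDetRepr_of_isEquivariant {Γ : Subgroup (GL σ k)} (hP : P.IsEquivariant Γ) :
    HasEquivariantDetRepr Γ P.eval (w * (L + 3)) := by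
  have hcard : Fintype.card (Vtx L w) = w * (L + 3) := by simp
  let e : Vtx L w ≃ Fin (w * (L + 3)) := Fintype.equivFinOfCardEq hcard
  refine ⟨P.vmat.submatrix e.symm e.symm, P.isAffineDetRepr_vmat e, fun γ hγ => ?_⟩
  obtain ⟨Λ⟩ := hP γ hγ
  refine ⟨glReindex e (gGL Λ), glReindex e (hGL Λ), ?_⟩
  have hg : ((glReindex e (gGL Λ) : GL (Fin (w * (L + 3))) k) : Matrix _ _ k) =
      (Matrix.blockDiagonal (gBlk Λ)).submatrix e.symm e.symm := rfl
  have hh : (((glReindex e (hGL Λ))⁻¹ : GL (Fin (w * (L + 3))) k) : Matrix _ _ k) =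
      (Matrix.blockDiagonal (hInvBlk Λ)).submatrix e.symm e.symm := rfl
  have h1 : Matrix.blockDiagonal (hBlk Λ) * Matrix.blockDiagonal (hInvBlk Λ) = 1 := (hGL Λ).val_inv
  have h2 : (Matrix.blockDiagonal (hBlk Λ)).map (C : k →+* MvPolynomial σ k) *
      (Matrix.blockDiagonal (hInvBlk Λ)).map (C : k →+* MvPolynomial σ k) = 1 := by
    rw [← Matrix.map_mul, h1, Matrix.map_one _ C_0 C_1]
  have hV : Matrix.linSubstEntries γ P.vmat =
      (Matrix.blockDiagonal (gBlk Λ)).map (C : k →+* MvPolynomial σ k) * P.vmat *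
        (Matrix.blockDiagonal (hInvBlk Λ)).map (C : k →+* MvPolynomial σ k) := by
    calc Matrix.linSubstEntries γ P.vmat
        = Matrix.linSubstEntries γ P.vmat * ((Matrix.blockDiagonal (hBlk Λ)).map (C : k →+* MvPolynomial σ k) *
            (Matrix.blockDiagonal (hInvBlk Λ)).map (C : k →+* MvPolynomial σ k)) := by rw [h2, Matrix.mul_one]
      _ = _ := by rw [← Matrix.mul_assoc, ← vmat_lift]
  rw [hg, hh, linSubstEntries_submatrix_aux, hV, ← Matrix.submatrix_mul_equiv _ _ e.symm e.symm e.symm,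
    ← Matrix.submatrix_mul_equiv _ _ e.symm e.symm e.symm, Matrix.submatrix_map, Matrix.submatrix_map]

end LayeredABP

/-- **Bridge, existential form.** Equivariant layered width `w` in length `L` gives an exactly equivariant
determinantal representation of size `≤ w (L + 3) + 1`. -/
theorem HasLayeredWidthLE.exists_hasEquivariantDetRepr [Fintype σ] [DecidableEq σ] {Γ : Subgroup (GL σ k)}
    {f : MvPolynomial σ k} (h : HasLayeredWidthLE Γ f L w) :
    ∃ s : ℕ, s ≤ w * (L + 3) + 1 ∧ HasEquivariantDetRepr Γ f s := by
  obtain ⟨P, hP, rfl⟩ := h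
  rcases Nat.eq_zero_or_pos w with rfl | hw
  · refine ⟨1, by omega, ?_⟩
    rw [P.eval_eq_zero_of_width_zero]
    exact hasEquivariantDetRepr_zero_one
  · haveI : NeZero w := ⟨hw.ne'⟩
    exact ⟨w * (L + 3), by omega, P.hasEquivariantDetRepr_of_isEquivariant hP⟩

end Lifts

/-! ## §5 The layered notch sits below cell A: kernels -/

section CellBridge

variable {H : ∀ m : ℕ, Subgroup (GL (Fin m × Fin m) ℂ)}

/-- KERNEL (Valiant's construction, equivariantly): polynomial equivariant layered width gives polynomial
exactly-equivariant determinantal complexity. -/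
theorem polyEquivariant_of_polyLayered (h : PolyLayered H) : PolyEquivariant H := by
  obtain ⟨c, hc⟩ := h
  obtain ⟨c', hc'⟩ := isPBounded_cost 2 2 c
  refine ⟨c', fun m => ?_⟩
  obtain ⟨w, hw, hW⟩ := hc m
  obtain ⟨s, hs, hA⟩ := hW.exists_hasEquivariantDetRepr
  refine ⟨s, hs.trans (le_trans ?_ (hc' m)), hA⟩
  have h1 : w * (m + 3) ≤ (m ^ c + c) * (m + 3) := Nat.mul_le_mul_right _ hw
  nlinarith [h1, Nat.zero_le m, Nat.zero_le (m ^ c + c)]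

/-- KERNEL: `A ⟹ A^lay` — exact-equivariant hardness descends to the layered notch. -/
theorem eqHardLayered_of_eqHard (h : EqHard H) : EqHardLayered H :=
  fun hl => h (polyEquivariant_of_polyLayered hl)

/-- At the bi-permutation notch: `EqHardBiPerm ⟹ EqHardLayeredBiPerm`. -/
theorem eqHardLayeredBiPerm_of_eqHardBiPerm (h : EqHardBiPerm) : EqHardLayeredBiPerm :=
  eqHardLayered_of_eqHard h

/-- `dc(per)` superpolynomial ⟹ the layered notch. -/
theorem eqHardLayeredBiPerm_of_dcPerSuperpolynomial (h : DcPerSuperpolynomial ℂ) : EqHardLayeredBiPerm :=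
  eqHardLayeredBiPerm_of_eqHardBiPerm (eqHard_of_dcPerSuperpolynomial h)

/-- `S ⟹ A^lay`: the summit implies the layered notch (so `A^lay` is a NECESSARY piece, never a costume
for `S`: nothing here proves the converse). -/
theorem eqHardLayeredBiPerm_of_summit (hS : _root_.ValiantsHypothesis) : EqHardLayeredBiPerm :=
  eqHardLayeredBiPerm_of_eqHardBiPerm (eqHardBiPerm_of_summit hS)

end CellBridge

end

end Summit.ValiantsHypothesis.ValiantsHypothesis.Theorems.EquivariantDialLayers
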